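import Literature.AlgebraicGeometry.Resolution.FlatSlicingCriterion
import Mathlib.RingTheory.Regular.RegularSequence
import Mathlib.RingTheory.Artinian.Module
import Mathlib.RingTheory.Ideal.Quotient.Operations
import HarnessLib

/-!
# [OURS · L1 W4.5(b) · EL♮(3) · (T-k) · brick J1a] Lifting a regular sequence along an Artinian thickening keeps flatness — the algebra core of
# R. Hartshorne, *Deformation Theory* (2010), Thm. 9.2 (b) (= Matsumura, Cor. to Thm. 22.5, for `M = B` over an ARTINIAN local base, `B` not local)

Crux chain w45b (cell `res-hironaka`, slot W4.5(b)), working crux **EL♮** = stmt-ResolutionOfSingularities-20038, child **EL♮(3)** =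
stmt-ResolutionOfSingularities-20148; NEED-FACT of record J1 = `EmbeddedInfinitesimalLiftFact` (…NatEmbeddedInfinitesimalLiftFactDefs, p596985:
Hartshorne 2010 Thm. 6.2 (b) + 9.2 (b) over `O/𝔪ⁿ⁺² ↠ O/𝔪ⁿ⁺¹`). Written by res-type-027 g16 on res-L1-w45b-plan-1's WORD 2026-08-28T02:37:47Z
(«COMMISSION J1a … as a PURE-ALGEBRA file»); J1-PROOF census `Cruxes/EquisingularLiftNatThree/Lines/J1-PROOF-CENSUS-res-type-027.md`.
HONEST FRAMING: OURS; NOT a statement of H. Hironaka's 2017 manuscript; AI-written, gate-checked, weaker than expert review. No `sorry`; standard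
axioms; DEF-FREE. `--supports stmt-ResolutionOfSingularities-20148 --as helper`.

WHAT. For an ARTINIAN local base `(A, 𝔪)` and an `A`-FLAT algebra `B` (not necessarily local, not necessarily Noetherian):
* `isSMulRegular_and_flat_quotient_span_singleton_of_fiber` — if `x ∈ B` is a nonzerodivisor on the fibre `B/𝔪B` then `x` is a nonzerodivisor on `B`
  and `B/xB` is flat over `A`;
* `isWeaklyRegular_and_flat_quotient_of_isWeaklyRegular_fiber` — if `x₁, …, x_r ∈ B` restrict to a weakly regular sequence on `B/𝔪B` then they form
  a weakly regular sequence on `B` and `B/(x₁, …, x_r)` is flat over `A`.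
This is exactly the local-existence step of Hartshorne's Thm. 9.2 (b) («If `a'_1, …, a'_r` are any liftings of the `a_i` to `A'`, then the Koszul
complex … is exact and defines a quotient `B' = A'/I'`, flat over `C'`», p. 87) in the instance the (T-k) chain needs: `A = C' = O/𝔪ⁿ⁺²` Artinian local,
`B = A'` an affine piece of the flat thickening `W_{n+1}`, the `x_i` lifts of the regular sequence cutting out `Y₀` in `W₀ = B/𝔪B`.
TREE INPUTS BY NAME (nothing re-proved): `Literature.AlgebraicGeometry.Resolution.Matsumura1987.isSMulRegular_baseChange_of_isFiniteLength`
(`x` regular on `B/𝔪B` ⇒ regular on `B ⊗_A N` for `N` of finite length — every `A/I` has finite length over an Artinian `A`),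
`…isSMulRegular_baseChange_quotient_iff`, `…isSMulRegular_quotient_iff`, `…flat_quotient_span_singleton_of_forall_isSMulRegular` (FlatSlicingCriterion,
which proves the Noetherian-LOCAL-`B` form `isSMulRegular_and_flat_quotient_of_isSMulRegular_fiber`); Mathlib `RingTheory.Sequence.isWeaklyRegular_cons_iff`,
`isWeaklyRegular_map_algebraMap_iff`, `DoubleQuot.quotQuotEquivQuotSupₐ`, `Module.Flat.of_linearEquiv`. The induction passes from `B` to the flat
`A`-algebra `B/x₁B`, whose fibre is `(B/𝔪B)/x̄₁` (`smul_top_eq_restrictScalars_span` + double-quotient isomorphisms).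

References (method / index only): R. Hartshorne, *Deformation Theory* (2010), Thm. 9.2 (b), p. 87; H. Matsumura, *Commutative Ring Theory* (1986),
§22, Thm. 22.5 and Corollary; EGA 0_IV 15.1.16.
-/

set_option linter.dupNamespace false

noncomputable section

open IsLocalRing RingTheory.Sequence TensorProduct Pointwise
open Literature.AlgebraicGeometry.Resolution

namespace Summit.ResolutionOfSingularities.ResolutionOfSingularities.Cruxes.EquisingularLiftNat.Sections

universe u v

variable {A : Type u} [CommRing A] [IsLocalRing A] [IsArtinianRing A]

/-- **One element (Matsumura, Cor. to Thm. 22.5, over an ARTINIAN local base, `B` not necessarily local).** If `B` is flat over the Artinian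
local ring `A` and `x ∈ B` is a nonzerodivisor on the fibre `B/𝔪B`, then `x` is a nonzerodivisor on `B` and `B/xB` is flat over `A`.
(Every `A/I` has finite length, so `x` is a nonzerodivisor on every `B/IB` by the tree's `isSMulRegular_baseChange_of_isFiniteLength`; then
`flat_quotient_span_singleton_of_forall_isSMulRegular`.) [cite: Matsumura1987, §22, Corollary to Thm. 22.5] -/
theorem isSMulRegular_and_flat_quotient_span_singleton_of_fiber {B : Type v} [CommRing B] [Algebra A B] [Module.Flat A B] {x : B}
    (hx : IsSMulRegular (B ⧸ (maximalIdeal A).map (algebraMap A B)) x) :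
    IsSMulRegular B x ∧ Module.Flat A (B ⧸ Ideal.span {x}) := by
  have hreg : ∀ I : Ideal A, IsSMulRegular (B ⧸ I.map (algebraMap A B)) x := fun I => by
    have hfl : IsFiniteLength A (A ⧸ I) := isFiniteLength_iff_isNoetherian_isArtinian.mpr ⟨inferInstance, inferInstance⟩
    exact (Matsumura1987.isSMulRegular_baseChange_quotient_iff I).mp (Matsumura1987.isSMulRegular_baseChange_of_isFiniteLength hx hfl)
  refine ⟨?_, Matsumura1987.flat_quotient_span_singleton_of_forall_isSMulRegular hreg⟩
  have h0 := hreg ⊥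
  rw [Matsumura1987.isSMulRegular_quotient_iff] at h0
  refine (isSMulRegular_iff_right_eq_zero_of_smul (M := B) (r := x)).mpr fun b hb => ?_
  have hb' : x * b ∈ (⊥ : Ideal A).map (algebraMap A B) := by
    rw [Ideal.map_bot]; exact hb
  have := h0 b hb'
  rwa [Ideal.map_bot] at this

/-- The submodule `x • ⊤` of a quotient ring `B ⧸ J`, seen over `B`, is (the restriction of scalars of) the ideal generated by the class of `x`.
[folklore] -/
theorem smul_top_eq_restrictScalars_span {B : Type v} [CommRing B] (J : Ideal B) (x : B) :
    x • (⊤ : Submodule B (B ⧸ J)) = (Ideal.span {Ideal.Quotient.mk J x}).restrictScalars B := by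
  ext y
  constructor
  · intro hy
    rw [Submodule.mem_smul_pointwise_iff_exists] at hy
    obtain ⟨z, -, rfl⟩ := hy
    obtain ⟨b, rfl⟩ := Ideal.Quotient.mk_surjective z
    change x • Ideal.Quotient.mk J b ∈ Ideal.span {Ideal.Quotient.mk J x}
    rw [Algebra.smul_def, Ideal.Quotient.algebraMap_eq]
    exact Ideal.mul_mem_right _ _ (Ideal.subset_span rfl)
  · intro hy
    change y ∈ Ideal.span {Ideal.Quotient.mk J x} at hy
    obtain ⟨c, rfl⟩ := Ideal.mem_span_singleton'.mp hy
    obtain ⟨b, rfl⟩ := Ideal.Quotient.mk_surjective c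
    rw [Submodule.mem_smul_pointwise_iff_exists]
    refine ⟨Ideal.Quotient.mk J b, Submodule.mem_top, ?_⟩
    rw [Algebra.smul_def, Ideal.Quotient.algebraMap_eq, mul_comm]

/-- **J1a — a sequence (Hartshorne 2010 Thm. 9.2 (b), algebra core; Matsumura Cor. to 22.5 for `M = B` over an Artinian local base).** If `B`
is flat over the Artinian local ring `A` and `x₁, …, x_r ∈ B` restrict to a weakly regular sequence on the fibre `B/𝔪B`, then `x₁, …, x_r` is a
weakly regular sequence on `B` and `B/(x₁, …, x_r)` is flat over `A`. (Induction on `r`: the one-element case, then pass to the flat `A`-algebra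
`B/x₁B`, whose fibre is `(B/𝔪B)/x̄₁`.) [cite: Hartshorne2010, Thm. 9.2 (b)] [cite: Matsumura1987, §22, Corollary to Thm. 22.5]
[OURS · L1 W4.5b · (T-k) brick J1a] toward `stub_elnat_embeddedCurveLiftFact` / the NEED-FACT J1 `EmbeddedInfinitesimalLiftFact`; NOT a statement
of the manuscript. -/
theorem isWeaklyRegular_and_flat_quotient_of_isWeaklyRegular_fiber_aux (n : ℕ) :
    ∀ {B : Type v} [CommRing B] [Algebra A B] [Module.Flat A B] (xs : List B), xs.length = n →
      IsWeaklyRegular (B ⧸ (maximalIdeal A).map (algebraMap A B)) xs →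
      IsWeaklyRegular B xs ∧ Module.Flat A (B ⧸ Ideal.ofList xs) := by
  induction n with
  | zero =>
    intro B _ _ _ xs hlen _
    obtain rfl : xs = [] := List.eq_nil_of_length_eq_zero hlen
    refine ⟨IsWeaklyRegular.nil B B, ?_⟩
    rw [Ideal.ofList_nil]
    exact Module.Flat.of_linearEquiv ((Submodule.quotEquivOfEqBot (⊥ : Ideal B) rfl).restrictScalars A)
  | succ n ih =>
    intro B _ _ _ xs hlen h
    obtain ⟨x, xs, rfl⟩ : ∃ x xs', xs = x :: xs' := List.exists_cons_of_length_eq_add_one hlen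
    have hlen' : xs.length = n := by simpa using hlen
    set 𝔪B : Ideal B := (maximalIdeal A).map (algebraMap A B) with h𝔪B
    rw [isWeaklyRegular_cons_iff] at h
    obtain ⟨hx, hxs⟩ := h
    -- one element
    obtain ⟨hxB, hflat₁⟩ := isSMulRegular_and_flat_quotient_span_singleton_of_fiber (A := A) hx
    -- pass to `B₁ = B/xB`
    let B₁ := B ⧸ Ideal.span {x}
    haveI : Module.Flat A B₁ := hflat₁
    -- the fibre of `B₁` is `(B/𝔪B)/x̄`
    have h𝔪B₁ : (maximalIdeal A).map (algebraMap A B₁) = 𝔪B.map (Ideal.Quotient.mk (Ideal.span {x})) := by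
      rw [h𝔪B, Ideal.map_map]; rfl
    let e : QuotSMulTop x (B ⧸ 𝔪B) ≃ₗ[B] (B₁ ⧸ (maximalIdeal A).map (algebraMap A B₁)) :=
      (Submodule.quotEquivOfEq _ _ (smul_top_eq_restrictScalars_span 𝔪B x)) ≪≫ₗ
        (Submodule.Quotient.restrictScalarsEquiv B (Ideal.span {Ideal.Quotient.mk 𝔪B x})) ≪≫ₗ
        ((Ideal.quotientEquivAlgOfEq B (by rw [Ideal.map_span, Set.image_singleton]; rfl)).toLinearEquiv ≪≫ₗ
          (DoubleQuot.quotQuotEquivQuotSupₐ B 𝔪B (Ideal.span {x})).toLinearEquiv ≪≫ₗ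
          (Ideal.quotientEquivAlgOfEq B (sup_comm _ _)).toLinearEquiv ≪≫ₗ
          (DoubleQuot.quotQuotEquivQuotSupₐ B (Ideal.span {x}) 𝔪B).symm.toLinearEquiv ≪≫ₗ
          (Ideal.quotientEquivAlgOfEq B h𝔪B₁.symm).toLinearEquiv)
    have hxs₁ : IsWeaklyRegular (B₁ ⧸ (maximalIdeal A).map (algebraMap A B₁)) (xs.map (algebraMap B B₁)) := by
      rw [isWeaklyRegular_map_algebraMap_iff]
      exact (e.isWeaklyRegular_congr xs).mp hxs
    obtain ⟨hregs₁, hflat⟩ := ih (B := B₁) (xs.map (algebraMap B B₁)) (by simpa using hlen') hxs₁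
    refine ⟨?_, ?_⟩
    · rw [isWeaklyRegular_cons_iff]
      refine ⟨hxB, ?_⟩
      -- `QuotSMulTop x B ≅ B₁` as `B`-modules
      have hsm : x • (⊤ : Submodule B B) = Ideal.span {x} := by
        ext y
        rw [Submodule.mem_smul_pointwise_iff_exists, Ideal.mem_span_singleton']
        constructor
        · rintro ⟨z, -, rfl⟩; exact ⟨z, by rw [smul_eq_mul, mul_comm]⟩
        · rintro ⟨z, rfl⟩; exact ⟨z, Submodule.mem_top, by rw [smul_eq_mul, mul_comm]⟩
      have hregs₁' : IsWeaklyRegular B₁ xs := (isWeaklyRegular_map_algebraMap_iff B₁ B₁ xs).mp hregs₁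
      exact ((Submodule.quotEquivOfEq _ _ hsm).isWeaklyRegular_congr xs).mpr hregs₁'
    · -- `B ⧸ (x, xs) ≅ B₁ ⧸ (xs)`
      have e₂ : (B₁ ⧸ Ideal.ofList (xs.map (algebraMap B B₁))) ≃ₐ[B] B ⧸ Ideal.ofList (x :: xs) :=
        (Ideal.quotientEquivAlgOfEq B (by rw [← Ideal.map_ofList]; rfl)).trans
          ((DoubleQuot.quotQuotEquivQuotSupₐ B (Ideal.span {x}) (Ideal.ofList xs)).trans
            (Ideal.quotientEquivAlgOfEq B (by rw [Ideal.ofList_cons])))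
      exact Module.Flat.of_linearEquiv (e₂.toLinearEquiv.restrictScalars A).symm

/-- **J1a — a sequence (Hartshorne 2010 Thm. 9.2 (b), algebra core; Matsumura Cor. to 22.5 for `M = B` over an Artinian local base).** If `B`
is flat over the Artinian local ring `A` and `x₁, …, x_r ∈ B` restrict to a weakly regular sequence on the fibre `B/𝔪B`, then `x₁, …, x_r` is a
weakly regular sequence on `B` and `B/(x₁, …, x_r)` is flat over `A`. (Induction on `r`: the one-element case, then pass to the flat `A`-algebra
`B/x₁B`, whose fibre is `(B/𝔪B)/x̄₁`.) [cite: Hartshorne2010, Thm. 9.2 (b)] [cite: Matsumura1987, §22, Corollary to Thm. 22.5]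
[OURS · L1 W4.5b · (T-k) brick J1a] toward `stub_elnat_embeddedCurveLiftFact` / the NEED-FACT J1 `EmbeddedInfinitesimalLiftFact`; NOT a statement
of the manuscript. -/
theorem isWeaklyRegular_and_flat_quotient_of_isWeaklyRegular_fiber {B : Type v} [CommRing B] [Algebra A B] [Module.Flat A B]
    {xs : List B} (h : IsWeaklyRegular (B ⧸ (maximalIdeal A).map (algebraMap A B)) xs) :
    IsWeaklyRegular B xs ∧ Module.Flat A (B ⧸ Ideal.ofList xs) :=
  isWeaklyRegular_and_flat_quotient_of_isWeaklyRegular_fiber_aux xs.length xs rfl h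

end Summit.ResolutionOfSingularities.ResolutionOfSingularities.Cruxes.EquisingularLiftNat.Sections

end
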